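import Summits.ResolutionOfSingularities.ResolutionOfSingularities.Theorems.FrobeniusLadderFInjectiveMacaulayficationLoopGermLCure
import Summits.ResolutionOfSingularities.ResolutionOfSingularities.Theorems.FrobeniusLadderFInjectiveMacaulayficationKLocCellKitOff
import Summits.ResolutionOfSingularities.ResolutionOfSingularities.Theorems.FrobeniusLadderFInjectiveMacaulayficationKLocCellOff
import Summits.ResolutionOfSingularities.ResolutionOfSingularities.Theorems.FrobeniusLadderFInjectiveMacaulayficationAffineBlowupStalkClause
import Summits.ResolutionOfSingularities.ResolutionOfSingularities.Theorems.FrobeniusLadderFInjectiveMacaulayficationClauseOfMaximal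
import Summits.ResolutionOfSingularities.ResolutionOfSingularities.Theorems.FrobeniusLadderFInjectiveMacaulayficationLocalBlowupBadFibreFromCharts
import Summits.ResolutionOfSingularities.ResolutionOfSingularities.Theorems.FrobeniusLadderFInjectiveMacaulayficationFTemkinClosedPoints
import HarnessLib

/-!
# (O-3) ★★★ THE LOOP GERM IS CURED IN ONE SINGULAR-PLANE STEP — every blowing up of `U₀` along `(c̄,d̄,ē)` is FULL at EVERY point
# (crux `FInjectiveMacaulayfication` stmt-ResolutionOfSingularities-15315, chain w45a; res-L1-w45a-plan-1 g19 RULING R19.18 (ii), literal form; seat res-L1-w45a-stub-3 g10)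

[OURS · L1 W4.5a] Support file (`--supports stmt-ResolutionOfSingularities-15315 --as helper`); unconditional; def-free; replaces the role of NO printed item;
NOT a statement of the manuscript; AI-written (AI review is weaker than expert review). Sequel of `…LoopGermLCharts` (✓ p641754) and `…LoopGermLCure`.

`U₀ = Spec k[a,b,c,d,e]/(L)`, `L = e² + a²ce + ac² + acd² + ab³c²`, `char k = 2`, presented as `Spec k₀[c,d,e]/(L)`, `k₀ = k[a,b]`
(`LoopGermLCure.exists_presentationEquiv`); `𝓚 = (c̄,d̄,ē)~`.
* §1 (`k[X]`) ★ `offCentre_clause`: `U₀` carries the CM + Frobenius-closed clause at every maximal ideal NOT containing one of `c̄, d̄, ē` — `U₀` is F-pure off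
  the LINE `V(a,c,d,e) = rad τ(L)` ⊂ `V(c,d,e)`: the p-basis classes `a`, `ac`, `∅` of `L` have coefficients `c²`, `d²`, `e²`, units off `V(c)`, `V(d)`, `V(e)`
  (three OFF-cells of res-L1-w45a-stub-5's `KLocCellOff.honQuot_of_kLocCells_off`, certificate `KLocCellKit.checkKsOff` by `decide +kernel`); `L_not_dvd_X`.
* §2 (generic coefficient domain `A ∋ a,b`, as in `LoopGermLCure` §1) ★★ `cure_all_of_clauses`: FULL at EVERY point of the model `affineBlowup 𝓚`, from the chart
  clauses over the centre AND a supplied off-centre stalk clause, by res's `AffineBlowupStalkClause.stub_affineBlowupStalkClause` (E6″).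
* §3 (`A = k[a,b]`) ★★★ `loopGerm_cure_model` (every stalk of `affineBlowup 𝓚 → U₀` is FULL; the off-centre input moved from §1 along the presentation
  isomorphism with a Jacobson step and `ClauseOfMaximal.fiClause_atPrime_of_le`) and ★★★ `loopGerm_cure` — THE DESK'S LITERAL FORM (R19.18 (ii)):
  `∀ (S″ : Scheme) (π : S″ ⟶ U₀), IsBlowup π 𝓚 → ∀ s, FullCl 2 (S″.presheaf.stalk s)` (`IsBlowup.unique` + isomorphic stalks).
[folklore mathematics, OURS as a certificate; cite: Fedder1983, Prop. 1.7 and Thm. 1.12; StacksProject, Tag 0804 and Tag 080E; GortzWedhorn2020, Prop. 13.92]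
-/

-- single-problem summit: the doubled namespace component is forced
set_option linter.dupNamespace false

noncomputable section

open AlgebraicGeometry CategoryTheory Literature.AlgebraicGeometry.Resolution TopologicalSpace IsLocalRing MvPolynomial

namespace Summit.ResolutionOfSingularities.ResolutionOfSingularities.Theorems.FInjectiveMacaulayfication.LoopGermLCureAll

open Summit.ResolutionOfSingularities.ResolutionOfSingularities.Theorems.FInjectiveMacaulayfication
open SliceableCentre

/-! ## §1 `U₀` is F-pure (and CM) off the centre: three OFF-cells -/

section OffCentre

variable (k : Type) [Field k]

/-- No variable divides `L`. [certificate] -/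
theorem L_not_dvd_X (f : MvPolynomial (Fin 5) k) (hf : f = X 4 ^ 2 + X 0 ^ 2 * X 2 * X 4 + X 0 * X 2 ^ 2 + X 0 * X 2 * X 3 ^ 2 + X 0 * X 1 ^ 3 * X 2 ^ 2) : ∀ i : Fin 5, ¬ ((X i : MvPolynomial (Fin 5) k) ∣ f) := by
  intro i h
  obtain ⟨c, hc⟩ := h
  by_cases hi : i = 4
  · subst hi
    have := congrArg (MvPolynomial.eval ![(1 : k), 0, 1, 0, 0]) hc
    rw [hf] at this
    simp at this
  · have := congrArg (MvPolynomial.eval (Pi.single 4 1 : Fin 5 → k)) hc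
    rw [hf] at this
    simp [hi] at this

/-- `L` is the value of its term list. [plumbing] -/
theorem L_eq_evalL : (X 4 ^ 2 + X 0 ^ 2 * X 2 * X 4 + X 0 * X 2 ^ 2 + X 0 * X 2 * X 3 ^ 2 + X 0 * X 1 ^ 3 * X 2 ^ 2 : MvPolynomial (Fin 5) k) = KLocCellKit.evalL k [((1 : ℤ), ![0, 0, 0, 0, 2]), ((1 : ℤ), ![2, 0, 1, 0, 1]), ((1 : ℤ), ![1, 0, 2, 0, 0]), ((1 : ℤ), ![1, 0, 1, 2, 0]), ((1 : ℤ), ![1, 3, 2, 0, 0])] := by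
  simp only [KLocCellKit.evalL, List.map_cons, List.map_nil, List.sum_cons, List.sum_nil, Int.cast_one, PConeFedderData.monomial_five]
  ring

/-- The avoid list `[c, d, e]` as values of term lists. [plumbing] -/
theorem evalL_c : KLocCellKit.evalL k [((1 : ℤ), ![0, 0, 1, 0, 0])] = (X 2 : MvPolynomial (Fin 5) k) := by
  simp only [KLocCellKit.evalL, List.map_cons, List.map_nil, List.sum_cons, List.sum_nil, Int.cast_one, PConeFedderData.monomial_five]
  ring

/-- The avoid list `[c, d, e]` as values of term lists. [plumbing] -/
theorem evalL_d : KLocCellKit.evalL k [((1 : ℤ), ![0, 0, 0, 1, 0])] = (X 3 : MvPolynomial (Fin 5) k) := by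
  simp only [KLocCellKit.evalL, List.map_cons, List.map_nil, List.sum_cons, List.sum_nil, Int.cast_one, PConeFedderData.monomial_five]
  ring

/-- The avoid list `[c, d, e]` as values of term lists. [plumbing] -/
theorem evalL_e : KLocCellKit.evalL k [((1 : ℤ), ![0, 0, 0, 0, 1])] = (X 4 : MvPolynomial (Fin 5) k) := by
  simp only [KLocCellKit.evalL, List.map_cons, List.map_nil, List.sum_cons, List.sum_nil, Int.cast_one, PConeFedderData.monomial_five]
  ring

set_option maxHeartbeats 800000 in
-- one kernel `decide` for the three off-cells + the off-cell engine
/-- ★ **`U₀` OFF THE CENTRE**: `k[X]/(L)` satisfies the CM + Frobenius-closed clause at every maximal ideal missing one of `c̄, d̄, ē` (`char k = 2`). The three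
OFF-cells: `c² · a`, `d² · ac`, `e² · 1` are terms of the p-basis split of `L` with coefficients `c², d², e²` — so `h² ∈ (split coefficients)` for `h = c, d, e`
(Fedder: `L ∉ 𝔫^{[2]}` when `h ∉ 𝔫`). NOT claimed at maximal ideals containing `(c,d,e)` (false on the line `V(a,c,d,e)`). [cite: Fedder1983, Prop. 1.7, Thm. 1.12] -/
theorem offCentre_clause [CharP k 2] (f : MvPolynomial (Fin 5) k) (hf : f = X 4 ^ 2 + X 0 ^ 2 * X 2 * X 4 + X 0 * X 2 ^ 2 + X 0 * X 2 * X 3 ^ 2 + X 0 * X 1 ^ 3 * X 2 ^ 2)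
    (Q' : Ideal (MvPolynomial (Fin 5) k ⧸ Ideal.span {f})) [Q'.IsMaximal]
    (hQ' : Ideal.Quotient.mk (Ideal.span {f}) (X 2) ∉ Q' ∨ Ideal.Quotient.mk (Ideal.span {f}) (X 3) ∉ Q' ∨ Ideal.Quotient.mk (Ideal.span {f}) (X 4) ∉ Q') :
    ∀ d : ℕ, ringKrullDim (Localization.AtPrime Q') = d → ∀ s : Fin d → Localization.AtPrime Q',
      (Ideal.span (Set.range s)).radical.IsMaximal →
        RingTheory.Sequence.IsWeaklyRegular (Localization.AtPrime Q') (List.ofFn s) ∧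
        ∀ y : Localization.AtPrime Q', (∃ n : ℕ, y ^ 2 ^ n ∈ Ideal.span
          ((fun z : Localization.AtPrime Q' => z ^ 2 ^ n) '' (Ideal.span (Set.range s) : Set (Localization.AtPrime Q')))) → y ∈ Ideal.span (Set.range s) := by
  classical
  haveI : Fact (Nat.Prime 2) := ⟨Nat.prime_two⟩
  have hL := L_eq_evalL k
  have hf' : f = KLocCellKit.evalL k [((1 : ℤ), ![0, 0, 0, 0, 2]), ((1 : ℤ), ![2, 0, 1, 0, 1]), ((1 : ℤ), ![1, 0, 2, 0, 0]), ((1 : ℤ), ![1, 0, 1, 2, 0]), ((1 : ℤ), ![1, 3, 2, 0, 0])] := hf.trans hL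
  subst hf'
  have hg0 : KLocCellKit.evalL k [((1 : ℤ), ![0, 0, 0, 0, 2]), ((1 : ℤ), ![2, 0, 1, 0, 1]), ((1 : ℤ), ![1, 0, 2, 0, 0]), ((1 : ℤ), ![1, 0, 1, 2, 0]), ((1 : ℤ), ![1, 3, 2, 0, 0])] ≠ 0 := by
    rw [← hL]; exact (LoopGermLCharts.prime_L k _ rfl).ne_zero
  have hX : ∀ i : Fin 5, ¬ ((X i : MvPolynomial (Fin 5) k) ∣ KLocCellKit.evalL k [((1 : ℤ), ![0, 0, 0, 0, 2]), ((1 : ℤ), ![2, 0, 1, 0, 1]), ((1 : ℤ), ![1, 0, 2, 0, 0]), ((1 : ℤ), ![1, 0, 1, 2, 0]), ((1 : ℤ), ![1, 3, 2, 0, 0])]) := by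
    rw [← hL]; exact L_not_dvd_X k _ rfl
  have hcellsOff := KLocCellKit.offCells_of_check (K := k) 2
    [((1 : ℤ), ![0, 0, 0, 0, 2]), ((1 : ℤ), ![2, 0, 1, 0, 1]), ((1 : ℤ), ![1, 0, 2, 0, 0]), ((1 : ℤ), ![1, 0, 1, 2, 0]), ((1 : ℤ), ![1, 3, 2, 0, 0])]
    [(∅ : Finset (Fin 5))] [[((1 : ℤ), ![0, 0, 1, 0, 0])], [((1 : ℤ), ![0, 0, 0, 1, 0])], [((1 : ℤ), ![0, 0, 0, 0, 1])]]
    [((∅ : Finset (Fin 5)), [(![1, 0, 0, 0, 0], [((1 : ℤ), ![0, 0, 0, 0, 0])])], (fun _ => []), [], [((1 : ℤ), ![0, 0, 1, 0, 0])], 2),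
      ((∅ : Finset (Fin 5)), [(![1, 0, 1, 0, 0], [((1 : ℤ), ![0, 0, 0, 0, 0])])], (fun _ => []), [], [((1 : ℤ), ![0, 0, 0, 1, 0])], 2),
      ((∅ : Finset (Fin 5)), [(![0, 0, 0, 0, 0], [((1 : ℤ), ![0, 0, 0, 0, 0])])], (fun _ => []), [], [((1 : ℤ), ![0, 0, 0, 0, 1])], 2)]
    (by decide +kernel) (by decide)
  have H := KLocCellOff.honQuot_of_kLocCells_off 2 k 5 (∅ : Finset (Fin 5)) (1 : Matrix (Fin 5) (Fin 5) ℕ) (KLocCellKit.evalL k [((1 : ℤ), ![0, 0, 0, 0, 2]), ((1 : ℤ), ![2, 0, 1, 0, 1]), ((1 : ℤ), ![1, 0, 2, 0, 0]), ((1 : ℤ), ![1, 0, 1, 2, 0]), ((1 : ℤ), ![1, 3, 2, 0, 0])])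
    hg0 hX [] [(∅ : Finset (Fin 5))] (([[((1 : ℤ), ![0, 0, 1, 0, 0])], [((1 : ℤ), ![0, 0, 0, 1, 0])], [((1 : ℤ), ![0, 0, 0, 0, 1])]] : List (List (ℤ × (Fin 5 → ℕ)))).map (KLocCellKit.evalL k))
    (fun T _ => Or.inr ⟨∅, by simp, Finset.empty_subset T⟩) (by simp) hcellsOff Q' (by simp) ?_
  · exact H.2
  · rcases hQ' with h | h | h
    · exact ⟨_, List.mem_map.mpr ⟨_, by simp, evalL_c k⟩, h⟩
    · exact ⟨_, List.mem_map.mpr ⟨_, by simp, evalL_d k⟩, h⟩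
    · exact ⟨_, List.mem_map.mpr ⟨_, by simp, evalL_e k⟩, h⟩

end OffCentre

/-! ## §2 Generic coefficients: FULL at every point of the model from the chart clauses and an off-centre stalk clause -/

section Generic

variable (A : Type) [CommRing A] [IsDomain A] (a b : A)

variable [IsNoetherianRing A] [CharP A 2]

set_option maxHeartbeats 2400000 in
-- E6″ + the Rees-chart identifications
/-- ★★ **FULL AT EVERY POINT, generic coefficients.** `A` a noetherian domain of characteristic `2`, `a b : A`, `U₀ = Spec A[c,d,e]/(L)`, `𝓚 = (c̄,d̄,ē)`; if `L` is
prime, `L, L_j ∉ (X_j)`, each `A[c,d,e]/(L_j)` carries the CM + Frobenius-closed clause at every maximal ideal, and the local rings of `U₀` at primes NOT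
containing `𝓚` are FULL, then EVERY stalk of `affineBlowup 𝓚` is FULL (`AffineBlowupStalkClause.stub_affineBlowupStalkClause`; the Rees charts are `≅ blowupAlgebra`
(`ReesChartFacts.exists_reesChartEquiv`), where `LoopGermLCure.hon_chart` gives the clause). [folklore glue; cite: StacksProject, Tag 0804] -/
theorem cure_all_of_clauses (F : MvPolynomial (Fin 3) A) (hF : F = X 2 ^ 2 + C (a ^ 2) * X 0 * X 2 + C a * X 0 ^ 2 + C a * X 0 * X 1 ^ 2 + C (a * b ^ 3) * X 0 ^ 2)
    (G : Fin 3 → MvPolynomial (Fin 3) A) (hG : G = ![X 2 ^ 2 + C (a ^ 2) * X 2 + C a + C a * X 0 * X 1 ^ 2 + C (a * b ^ 3),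
      X 2 ^ 2 + C (a ^ 2) * X 0 * X 2 + C a * X 0 ^ 2 + C a * X 0 * X 1 + C (a * b ^ 3) * X 0 ^ 2,
      1 + C (a ^ 2) * X 0 + C a * X 0 ^ 2 + C a * X 0 * X 1 ^ 2 * X 2 + C (a * b ^ 3) * X 0 ^ 2]) (hFp : Prime F)
    (hnm : ∀ j : Fin 3, F ∉ Ideal.span {(X j : MvPolynomial (Fin 3) A)} ∧ G j ∉ Ideal.span {(X j : MvPolynomial (Fin 3) A)})
    (hcl : ∀ (j : Fin 3) (Q' : Ideal (MvPolynomial (Fin 3) A ⧸ Ideal.span {G j})) [Q'.IsMaximal],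
      ∀ d : ℕ, ringKrullDim (Localization.AtPrime Q') = d → ∀ s : Fin d → Localization.AtPrime Q',
      (Ideal.span (Set.range s)).radical.IsMaximal →
        RingTheory.Sequence.IsWeaklyRegular (Localization.AtPrime Q') (List.ofFn s) ∧
        ∀ y : Localization.AtPrime Q', (∃ n : ℕ, y ^ 2 ^ n ∈ Ideal.span
          ((fun z : Localization.AtPrime Q' => z ^ 2 ^ n) '' (Ideal.span (Set.range s) : Set (Localization.AtPrime Q')))) → y ∈ Ideal.span (Set.range s))
    (hoff : ∀ (P : Ideal (MvPolynomial (Fin 3) A ⧸ Ideal.span {F})) [P.IsPrime], ¬ Ideal.span (Set.range fun l : Fin 3 => Ideal.Quotient.mk (Ideal.span {F}) (X l)) ≤ P →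
      IsDomain (Localization.AtPrime P) ∧
      ∀ d : ℕ, ringKrullDim (Localization.AtPrime P) = d → ∀ s : Fin d → Localization.AtPrime P,
      (Ideal.span (Set.range s)).radical.IsMaximal →
        RingTheory.Sequence.IsWeaklyRegular (Localization.AtPrime P) (List.ofFn s) ∧
        ∀ y : Localization.AtPrime P, (∃ n : ℕ, y ^ 2 ^ n ∈ Ideal.span
          ((fun z : Localization.AtPrime P => z ^ 2 ^ n) '' (Ideal.span (Set.range s) : Set (Localization.AtPrime P)))) → y ∈ Ideal.span (Set.range s)) :
    ∀ y : ↥(affineBlowup (Ideal.span (Set.range fun l : Fin 3 => Ideal.Quotient.mk (Ideal.span {F}) (X l)))),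
      FullCl 2 ((affineBlowup (Ideal.span (Set.range fun l : Fin 3 => Ideal.Quotient.mk (Ideal.span {F}) (X l)))).presheaf.stalk y) := by
  classical
  haveI : Fact (Nat.Prime 2) := ⟨Nat.prime_two⟩
  have hFprime : (Ideal.span {F}).IsPrime := (Ideal.span_singleton_prime hFp.ne_zero).mpr hFp
  haveI : IsDomain (MvPolynomial (Fin 3) A ⧸ Ideal.span {F}) := Ideal.Quotient.isDomain _
  haveI : CharP (MvPolynomial (Fin 3) A ⧸ Ideal.span {F}) 2 :=
    FRationalResolution.charP_quotient_of_ne_top 2 _ fun h => hFp.not_unit (Ideal.span_singleton_eq_top.mp h)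
  have hxI : ∀ j : Fin 3, (fun l : Fin 3 => Ideal.Quotient.mk (Ideal.span {F}) (X l)) j ∈ Ideal.span (Set.range fun l : Fin 3 => Ideal.Quotient.mk (Ideal.span {F}) (X l)) :=
    fun j => Ideal.subset_span (Set.mem_range_self j)
  have hv0 : ∀ j : Fin 3, (fun l : Fin 3 => Ideal.Quotient.mk (Ideal.span {F}) (X l)) j ≠ 0 := fun j h0 =>
    PrimeTransfer.X_not_mem_span_of_isPrime hFprime (hnm j).1 (Ideal.Quotient.eq_zero_iff_mem.mp h0)
  have hIne : Ideal.span (Set.range fun l : Fin 3 => Ideal.Quotient.mk (Ideal.span {F}) (X l)) ≠ ⊥ := fun hbot =>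
    hv0 0 ((Submodule.eq_bot_iff _).mp hbot _ (hxI 0))
  -- the clause on each vertex chart `blowupAlgebra 𝓚 x̄_j` (`LoopGermLCure.hon_chart`)
  have hch : ∀ (j : Fin 3) (Q' : Ideal (blowupAlgebra (Ideal.span (Set.range fun l : Fin 3 => Ideal.Quotient.mk (Ideal.span {F}) (X l))) ((fun l : Fin 3 => Ideal.Quotient.mk (Ideal.span {F}) (X l)) j))) [Q'.IsMaximal],
      ∀ d : ℕ, ringKrullDim (Localization.AtPrime Q') = d → ∀ s : Fin d → Localization.AtPrime Q',
      (Ideal.span (Set.range s)).radical.IsMaximal →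
        RingTheory.Sequence.IsWeaklyRegular (Localization.AtPrime Q') (List.ofFn s) ∧
        ∀ y : Localization.AtPrime Q', (∃ n : ℕ, y ^ 2 ^ n ∈ Ideal.span
          ((fun z : Localization.AtPrime Q' => z ^ 2 ^ n) '' (Ideal.span (Set.range s) : Set (Localization.AtPrime Q')))) → y ∈ Ideal.span (Set.range s) :=
    fun j Q' _ => LoopGermLCure.hon_chart A a b F hF G hG hFp hnm hcl j Q'
  intro y
  refine AffineBlowupStalkClause.stub_affineBlowupStalkClause 2 (MvPolynomial (Fin 3) A ⧸ Ideal.span {F}) (Ideal.span (Set.range fun l : Fin 3 => Ideal.Quotient.mk (Ideal.span {F}) (X l))) 3 (fun l : Fin 3 => Ideal.Quotient.mk (Ideal.span {F}) (X l)) hxI rfl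
    hIne hoff (fun j _ Q _ _ => ?_) y
  -- the homogeneous-localization model of E6″ `≅ blowupAlgebra` (`ReesChartFacts.exists_reesChartEquiv`)
  obtain ⟨e₁, -⟩ := ReesChartFacts.exists_reesChartEquiv (Ideal.span (Set.range fun l : Fin 3 => Ideal.Quotient.mk (Ideal.span {F}) (X l))) ((fun l : Fin 3 => Ideal.Quotient.mk (Ideal.span {F}) (X l)) j) (hxI j)
  exact E8Char5FiModel.clause_maximal_of_ringEquiv 2
    (A := HomogeneousLocalization.Away (reesGrading (Ideal.span (Set.range fun l : Fin 3 => Ideal.Quotient.mk (Ideal.span {F}) (X l)))) (reesT (I := Ideal.span (Set.range fun l : Fin 3 => Ideal.Quotient.mk (Ideal.span {F}) (X l))) ((fun l : Fin 3 => Ideal.Quotient.mk (Ideal.span {F}) (X l)) j) (hxI j)))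
    (B := blowupAlgebra (Ideal.span (Set.range fun l : Fin 3 => Ideal.Quotient.mk (Ideal.span {F}) (X l))) ((fun l : Fin 3 => Ideal.Quotient.mk (Ideal.span {F}) (X l)) j))
    e₁.symm 0 0 (map_zero _) (fun Q' _ _ => hch j Q') Q (Ideal.zero_mem Q)

end Generic

/-! ## §3 `A = k[a,b]`: every stalk of the model, and every blowing up along `𝓚` -/

section LoopGerm

variable (k : Type) [Field k]

set_option maxHeartbeats 1600000 in
-- §2 instantiated; the off-centre input carried along the presentation isomorphism
/-- ★★★ **EVERY STALK of `affineBlowup (c̄,d̄,ē) → U₀` IS FULL** (`U₀ = Spec k₀[c,d,e]/(L) = Spec k[a,…,e]/(L)`, `char k = 2`): over the centre by the three thin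
Fedder cells of the strict transforms (`LoopGermLCure.loopGerm_cure_over`'s inputs), off the centre because `U₀` is already FULL there (`offCentre_clause`, moved along
`LoopGermLCure.exists_presentationEquiv`, spread from maximal ideals to primes by a Jacobson step and `ClauseOfMaximal.fiClause_atPrime_of_le`).
[OURS; cite: Fedder1983, Thm. 1.12; StacksProject, Tag 0804] -/
theorem loopGerm_cure_model [CharP k 2] (F : MvPolynomial (Fin 3) (MvPolynomial (Fin 2) k)) (hF : F = X 2 ^ 2 + C (X 0 ^ 2) * X 0 * X 2 + C (X 0) * X 0 ^ 2 + C (X 0) * X 0 * X 1 ^ 2 + C (X 0 * X 1 ^ 3) * X 0 ^ 2) :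
    ∀ y : ↥(affineBlowup (Ideal.span (Set.range fun l : Fin 3 => Ideal.Quotient.mk (Ideal.span {F}) (X l)))),
      FullCl 2 ((affineBlowup (Ideal.span (Set.range fun l : Fin 3 => Ideal.Quotient.mk (Ideal.span {F}) (X l)))).presheaf.stalk y) := by
  classical
  haveI : Fact (Nat.Prime 2) := ⟨Nat.prime_two⟩
  obtain ⟨Φ, h0, h1, h2, ha, hb, -⟩ := LoopGermLCure.exists_flatten k
  have hv := LoopGermLCure.flatten_values k Φ h0 h1 h2 ha hb
  -- the `k[X]`-presentation `R = k[X]/(L)` and `Ψ : k₀[c,d,e]/(L) ≃ R`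
  set f : MvPolynomial (Fin 5) k := X 4 ^ 2 + X 0 ^ 2 * X 2 * X 4 + X 0 * X 2 ^ 2 + X 0 * X 2 * X 3 ^ 2 + X 0 * X 1 ^ 3 * X 2 ^ 2 with hf
  have hfprime : (Ideal.span {f}).IsPrime :=
    (Ideal.span_singleton_prime (LoopGermLCharts.prime_L k f hf).ne_zero).mpr (LoopGermLCharts.prime_L k f hf)
  haveI : IsDomain (MvPolynomial (Fin 5) k ⧸ Ideal.span {f}) := Ideal.Quotient.isDomain _
  haveI : CharP (MvPolynomial (Fin 5) k ⧸ Ideal.span {f}) 2 := charP_of_injective_algebraMap (algebraMap k _).injective 2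
  obtain ⟨Ψ, hΨ0, hΨ1, hΨ2, -, -⟩ := LoopGermLCure.exists_presentationEquiv k F hF f hf
  refine cure_all_of_clauses (MvPolynomial (Fin 2) k) (X 0) (X 1) F hF _ rfl (LoopGermLCure.prime_F k F hF) (LoopGermLCure.not_mem_span_X k F hF _ rfl) ?_ ?_
  · -- the chart clauses over the centre, along `Φ` (as in `LoopGermLCure.loopGerm_cure_over`)
    intro j Q' _
    obtain ⟨g, hΦg, hcl⟩ : ∃ g : MvPolynomial (Fin 5) k, Φ ((![X 2 ^ 2 + C (X 0 ^ 2) * X 2 + C (X 0) + C (X 0) * X 0 * X 1 ^ 2 + C (X 0 * X 1 ^ 3),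
      X 2 ^ 2 + C (X 0 ^ 2) * X 0 * X 2 + C (X 0) * X 0 ^ 2 + C (X 0) * X 0 * X 1 + C (X 0 * X 1 ^ 3) * X 0 ^ 2,
      1 + C (X 0 ^ 2) * X 0 + C (X 0) * X 0 ^ 2 + C (X 0) * X 0 * X 1 ^ 2 * X 2 + C (X 0 * X 1 ^ 3) * X 0 ^ 2] : Fin 3 → MvPolynomial (Fin 3) (MvPolynomial (Fin 2) k)) j) = g ∧
        ∀ (Q'' : Ideal (MvPolynomial (Fin 5) k ⧸ Ideal.span {g})) [Q''.IsMaximal],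
          ∀ d : ℕ, ringKrullDim (Localization.AtPrime Q'') = d → ∀ s : Fin d → Localization.AtPrime Q'',
      (Ideal.span (Set.range s)).radical.IsMaximal →
        RingTheory.Sequence.IsWeaklyRegular (Localization.AtPrime Q'') (List.ofFn s) ∧
        ∀ y : Localization.AtPrime Q'', (∃ n : ℕ, y ^ 2 ^ n ∈ Ideal.span
          ((fun z : Localization.AtPrime Q'' => z ^ 2 ^ n) '' (Ideal.span (Set.range s) : Set (Localization.AtPrime Q'')))) → y ∈ Ideal.span (Set.range s) := by
      fin_cases j
      · exact ⟨_, hv.2.1, fun Q'' _ => LoopGermLCharts.clause_chart_c k _ rfl Q''⟩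
      · exact ⟨_, hv.2.2.1, fun Q'' _ => LoopGermLCharts.clause_chart_d k _ rfl Q''⟩
      · exact ⟨_, hv.2.2.2, fun Q'' _ => LoopGermLCharts.clause_chart_e k _ rfl Q''⟩
    have hIJ : Ideal.span {(![X 2 ^ 2 + C (X 0 ^ 2) * X 2 + C (X 0) + C (X 0) * X 0 * X 1 ^ 2 + C (X 0 * X 1 ^ 3),
      X 2 ^ 2 + C (X 0 ^ 2) * X 0 * X 2 + C (X 0) * X 0 ^ 2 + C (X 0) * X 0 * X 1 + C (X 0 * X 1 ^ 3) * X 0 ^ 2,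
      1 + C (X 0 ^ 2) * X 0 + C (X 0) * X 0 ^ 2 + C (X 0) * X 0 * X 1 ^ 2 * X 2 + C (X 0 * X 1 ^ 3) * X 0 ^ 2] : Fin 3 → MvPolynomial (Fin 3) (MvPolynomial (Fin 2) k)) j} =
        Ideal.map (Φ.symm : MvPolynomial (Fin 5) k →+* MvPolynomial (Fin 3) (MvPolynomial (Fin 2) k)) (Ideal.span {g}) := by
      rw [Ideal.map_span, Set.image_singleton]
      have : Φ.symm g = (![X 2 ^ 2 + C (X 0 ^ 2) * X 2 + C (X 0) + C (X 0) * X 0 * X 1 ^ 2 + C (X 0 * X 1 ^ 3),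
      X 2 ^ 2 + C (X 0 ^ 2) * X 0 * X 2 + C (X 0) * X 0 ^ 2 + C (X 0) * X 0 * X 1 + C (X 0 * X 1 ^ 3) * X 0 ^ 2,
      1 + C (X 0 ^ 2) * X 0 + C (X 0) * X 0 ^ 2 + C (X 0) * X 0 * X 1 ^ 2 * X 2 + C (X 0 * X 1 ^ 3) * X 0 ^ 2] : Fin 3 → MvPolynomial (Fin 3) (MvPolynomial (Fin 2) k)) j := by
        rw [← hΦg, RingEquiv.symm_apply_apply]
      simp [this]
    exact E8Char5FiModel.clause_maximal_of_ringEquiv 2 (Ideal.quotientEquiv _ _ Φ.symm hIJ) 0 0 (map_zero _) (fun Q'' _ _ => hcl Q'') Q'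
      (Ideal.zero_mem Q')
  · -- off the centre: `U₀` is FULL there
    intro P _ hP
    -- a generator `x̄'_j ∉ P`, read in `R` as `x̄_(j+2) ∉ P₅ := Ψ(P)`
    have hex : ∃ j : Fin 3, (fun l : Fin 3 => Ideal.Quotient.mk (Ideal.span {F}) (X l)) j ∉ P := by
      by_contra hcon
      push Not at hcon
      exact hP (Ideal.span_le.mpr (by rintro _ ⟨j, rfl⟩; exact hcon j))
    obtain ⟨j, hj⟩ := hex
    set P₅ : Ideal (MvPolynomial (Fin 5) k ⧸ Ideal.span {f}) := P.comap Ψ.symm.toRingHom with hP₅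
    haveI : P₅.IsPrime := Ideal.comap_isPrime _ _
    have hj5 : Ideal.Quotient.mk (Ideal.span {f}) (X 2) ∉ P₅ ∨ Ideal.Quotient.mk (Ideal.span {f}) (X 3) ∉ P₅ ∨
        Ideal.Quotient.mk (Ideal.span {f}) (X 4) ∉ P₅ := by
      have key : ∀ (r : MvPolynomial (Fin 3) (MvPolynomial (Fin 2) k) ⧸ Ideal.span {F}) (r₅ : MvPolynomial (Fin 5) k ⧸ Ideal.span {f}), Ψ r = r₅ → r ∉ P → r₅ ∉ P₅ := by
        intro r r₅ hr hrP h5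
        apply hrP
        have : Ψ.symm r₅ ∈ P := h5
        rwa [← hr, RingEquiv.symm_apply_apply] at this
      fin_cases j
      · exact Or.inl (key _ _ hΨ0 hj)
      · exact Or.inr (Or.inl (key _ _ hΨ1 hj))
      · exact Or.inr (Or.inr (key _ _ hΨ2 hj))
    -- Jacobson: a maximal ideal `Q' ⊇ P₅` missing the same variable
    have hJ : P₅.jacobson = P₅ := IsJacobsonRing.out inferInstance (Ideal.IsPrime.isRadical ‹_›)
    have hexQ : ∃ Q' : Ideal (MvPolynomial (Fin 5) k ⧸ Ideal.span {f}), Q'.IsMaximal ∧ P₅ ≤ Q' ∧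
        (Ideal.Quotient.mk (Ideal.span {f}) (X 2) ∉ Q' ∨ Ideal.Quotient.mk (Ideal.span {f}) (X 3) ∉ Q' ∨
          Ideal.Quotient.mk (Ideal.span {f}) (X 4) ∉ Q') := by
      have one : ∀ t : MvPolynomial (Fin 5) k ⧸ Ideal.span {f}, t ∉ P₅ → ∃ Q' : Ideal (MvPolynomial (Fin 5) k ⧸ Ideal.span {f}), Q'.IsMaximal ∧ P₅ ≤ Q' ∧ t ∉ Q' := by
        intro t ht
        by_contra hcon
        push Not at hcon
        apply ht
        rw [← hJ, Ideal.jacobson, Ideal.mem_sInf]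
        rintro Q ⟨hPQ, hQ⟩
        exact hcon Q hQ hPQ
      rcases hj5 with h | h | h
      · obtain ⟨Q', h1, h2, h3⟩ := one _ h; exact ⟨Q', h1, h2, Or.inl h3⟩
      · obtain ⟨Q', h1, h2, h3⟩ := one _ h; exact ⟨Q', h1, h2, Or.inr (Or.inl h3)⟩
      · obtain ⟨Q', h1, h2, h3⟩ := one _ h; exact ⟨Q', h1, h2, Or.inr (Or.inr h3)⟩
    obtain ⟨Q', hQ'max, hPQ', hQ'⟩ := hexQ
    have h5 : FullCl 2 (Localization.AtPrime P₅) :=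
      ClauseOfMaximal.fiClause_atPrime_of_le 2 hPQ' ⟨inferInstance, offCentre_clause k f hf Q' hQ'⟩
    exact LocalBlowupBadFibreFromCharts.fullCl_localization_of_ringEquiv 2 Ψ.symm P₅ P rfl h5

/-- ★★★ **THE LOOP GERM IS CURED IN ONE SINGULAR-PLANE STEP** (R19.18 (ii), literal form): with `U₀ = Spec k₀[c,d,e]/(L)` (`= Spec k[a,b,c,d,e]/(L)`,
`LoopGermLCure.exists_presentationEquiv`), `L = e² + a²ce + ac² + acd² + ab³c²`, `char k = 2`, and `𝓚 := (c̄, d̄, ē)~` the ideal sheaf of the singular plane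
`V(c,d,e)` (`LoopGermLCharts.L_mem_sq_cde`): EVERY blowing up `π : S″ ⟶ U₀` along `𝓚` is FULL (domain, Cohen–Macaulay, F-injective) AT EVERY POINT of `S″`.
Contrast (R19.16, evidence): the Frobenius recipe blows up the line `rad τ(L) = (a,c,d,e)` and loops `L ⇄ M` forever. [OURS; cite: Fedder1983, Thm. 1.12;
GortzWedhorn2020, Prop. 13.92; StacksProject, Tag 0804] -/
theorem loopGerm_cure [CharP k 2] (F : MvPolynomial (Fin 3) (MvPolynomial (Fin 2) k)) (hF : F = X 2 ^ 2 + C (X 0 ^ 2) * X 0 * X 2 + C (X 0) * X 0 ^ 2 + C (X 0) * X 0 * X 1 ^ 2 + C (X 0 * X 1 ^ 3) * X 0 ^ 2) :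
    ∀ (S'' : Scheme.{0}) (π : S'' ⟶ Spec (.of (MvPolynomial (Fin 3) (MvPolynomial (Fin 2) k) ⧸ Ideal.span {F}))),
      IsBlowup π (affineBlowup.idealSheaf (Ideal.span (Set.range fun l : Fin 3 => Ideal.Quotient.mk (Ideal.span {F}) (X l)))) →
      ∀ s : S'', FullCl 2 (S''.presheaf.stalk s) := by
  have hFp := LoopGermLCure.prime_F k F hF
  haveI : (Ideal.span {F}).IsPrime := (Ideal.span_singleton_prime hFp.ne_zero).mpr hFp
  haveI : IsDomain (MvPolynomial (Fin 3) (MvPolynomial (Fin 2) k) ⧸ Ideal.span {F}) := Ideal.Quotient.isDomain _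
  have hIne : Ideal.span (Set.range fun l : Fin 3 => Ideal.Quotient.mk (Ideal.span {F}) (X l)) ≠ ⊥ := fun hbot =>
    PrimeTransfer.X_not_mem_span_of_isPrime ‹_› (LoopGermLCure.not_mem_span_X k F hF _ rfl 0).1
      (Ideal.Quotient.eq_zero_iff_mem.mp ((Submodule.eq_bot_iff _).mp hbot _ (Ideal.subset_span (Set.mem_range_self (0 : Fin 3)))))
  haveI : IsIntegral (affineBlowup (Ideal.span (Set.range fun l : Fin 3 => Ideal.Quotient.mk (Ideal.span {F}) (X l)))) :=
    affineBlowup.isIntegral (R := MvPolynomial (Fin 3) (MvPolynomial (Fin 2) k) ⧸ Ideal.span {F}) (I := Ideal.span (Set.range fun l : Fin 3 => Ideal.Quotient.mk (Ideal.span {F}) (X l))) hIne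
  intro S'' π hπ s
  obtain ⟨e, -, -⟩ := (affineBlowup.isBlowup (Ideal.span (Set.range fun l : Fin 3 => Ideal.Quotient.mk (Ideal.span {F}) (X l)))).unique hπ
  exact FTemkinClosedPoints.fullCl_of_isIso_stalkMap' 2 e.inv s (loopGerm_cure_model k F hF (e.inv.base s))

end LoopGerm

end Summit.ResolutionOfSingularities.ResolutionOfSingularities.Theorems.FInjectiveMacaulayfication.LoopGermLCureAll

end
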